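import Summits.CriticalPhenomena.PercolationContinuityZ3.Theorems.Transplant.SharpnessGridWedge
import Summits.CriticalPhenomena.PercolationContinuityZ3.Theorems.Transplant.SharpnessGridWalks
import Literature.Combinatorics.SimpleGraph.RoughIsometry
import HarnessLib

/-!
# Transplant sharpness XXXIII — the inclusion of the gridded wedge into `ℤ²` is a rough isometry (Lyons–Peres (2.20))

builds on p205010 (kernel theorem, internal audit signed; external expert review pending).
Status sentence (coordinator 2026-08-20T04:30Z): "θ(p_c) = 0 on ℤ^d, all d ≥ 2 — kernel-verified (Lean 4/Mathlib,
standard axioms); internal adversarial audit SIGNED 2026-08-20 04:29Z; external expert review pending."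

Lane `prim-bschramm`, seat p5 (sharpness); memo `run/shared/lean/prim/bschramm/P5-SHARPNESS.md` §40.2(i) / §42 (row 83,
column "rough-isometric to `ℤ²`").  In the vocabulary of Lyons–Peres §2.6 (`Literature.Combinatorics.SimpleGraph.IsRoughIsometry`,
Mathlib's `SimpleGraph.dist`):

* `zd_dist_eq_l1` — the graph distance of `ℤ²` is the `ℓ¹` distance;
* `gridWedge_dist_le` / `l1_le_gridWedge_dist` — `‖y - x‖₁ ≤ d_{G′}(x,y) ≤ ‖y - x‖₁ + 4M` in `G′_M = ℤ²[logWedge a b ∪ gridLines M]`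
  (`SharpnessGridWalks.exists_walk_length_le_of_wedge_grid`, `l1_le_length_induce`);
* `isRoughIsometry_val_gridWedge` — **the inclusion `V(G′_M) ↪ ℤ²` is a rough isometry with `α = 1`, `β = 4M`**
  (`a, b ≥ 0`, `M ≥ 1`; coboundedness from `gridLines_dense`); `roughlyIsometric_gridWedge_zd`.

References: R. Lyons, Y. Peres, *Probability on Trees and Networks* (2016), §2.6 (2.20); G. Grimmett, *Percolation* (1999), §11.5.
-/

noncomputable section

namespace Summit.CriticalPhenomena.PercolationContinuityZ3.Theorems.TransplantSharpness

open Literature.Probability.LatticeModels Literature.Barriers.CriticalPhenomena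
open Literature.Combinatorics.SimpleGraph (IsRoughIsometry RoughlyIsometric)

/-! ## The graph distance of `ℤ²` is `ℓ¹` -/

/-- A lattice walk of length `‖y - x‖₁` from `x` to `y` (row, then column). [folklore] -/
theorem exists_zdWalk_length_eq_l1 (x y : Site 2) :
    ∃ w : (zdGraph 2).Walk x y, (w.length : ℤ) = |y 0 - x 0| + |y 1 - x 1| := by
  have ex : x = ![x 0, x 1] := by funext k; fin_cases k <;> rfl
  have ey : y = ![y 0, y 1] := by funext k; fin_cases k <;> rfl
  obtain ⟨w₁, hw₁⟩ := exists_walk_row (S := Set.univ) (i := x 0) (i' := y 0) (j := x 1)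
    (fun _ _ _ => Set.mem_univ _) (Set.mem_univ _) (Set.mem_univ _)
  obtain ⟨w₂, hw₂⟩ := exists_walk_col (S := Set.univ) (i := y 0) (j := x 1) (j' := y 1)
    (fun _ _ _ => Set.mem_univ _) (Set.mem_univ _) (Set.mem_univ _)
  refine ⟨(((w₁.append w₂).map (SimpleGraph.Embedding.induce (Set.univ : Set (Site 2))).toHom).copy
    ex.symm ey.symm), ?_⟩
  rw [SimpleGraph.Walk.length_copy, SimpleGraph.Walk.length_map, SimpleGraph.Walk.length_append, Nat.cast_add,
    hw₁, hw₂]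

/-- **`d_{ℤ²}(x,y) = ‖y - x‖₁`.** [folklore] -/
theorem zd_dist_eq_l1 (x y : Site 2) : ((zdGraph 2).dist x y : ℤ) = |y 0 - x 0| + |y 1 - x 1| := by
  obtain ⟨w, hw⟩ := exists_zdWalk_length_eq_l1 x y
  refine le_antisymm ?_ ?_
  · have := SimpleGraph.dist_le w
    calc ((zdGraph 2).dist x y : ℤ) ≤ w.length := by exact_mod_cast this
      _ = _ := hw
  · obtain ⟨w', hw'⟩ := (w.reachable).exists_walk_length_eq_dist
    have := l1_le_length w'
    rw [hw'] at this
    exact this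

/-! ## Distances in the gridded wedge -/

variable {a b : ℝ} {M : ℕ}

/-- `d_{G′}(x,y) ≤ ‖y - x‖₁ + 4M` (`a, b ≥ 0`, `M ≥ 1`). [folklore] -/
theorem gridWedge_dist_le (ha : 0 ≤ a) (hb : 0 ≤ b) (hM : 1 ≤ M) (x y : gridWedge a b M) :
    ((gridWedgeGraph a b M).dist x y : ℤ) ≤
      |(y : Site 2) 0 - (x : Site 2) 0| + |(y : Site 2) 1 - (x : Site 2) 1| + 4 * M := by
  obtain ⟨w, hw⟩ := exists_walk_length_le_of_wedge_grid (a := a) (b := b) (S := gridWedge a b M) (M := M)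
    ha hb hM (logWedge_subset_gridWedge a b M) (fun z hz => Or.inr hz) (fun z hz => hz)
    (x : Site 2) (y : Site 2) x.2 y.2
  have := SimpleGraph.dist_le w
  calc ((gridWedgeGraph a b M).dist x y : ℤ) ≤ w.length := by exact_mod_cast this
    _ ≤ _ := hw

/-- `G′` is connected (`a, b ≥ 0`, `M ≥ 1`). [folklore] -/
theorem gridWedge_reachable (ha : 0 ≤ a) (hb : 0 ≤ b) (hM : 1 ≤ M) (x y : gridWedge a b M) :
    (gridWedgeGraph a b M).Reachable x y := by
  obtain ⟨w, -⟩ := exists_walk_length_le_of_wedge_grid (a := a) (b := b) (S := gridWedge a b M) (M := M)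
    ha hb hM (logWedge_subset_gridWedge a b M) (fun z hz => Or.inr hz) (fun z hz => hz)
    (x : Site 2) (y : Site 2) x.2 y.2
  exact ⟨w⟩

/-- `‖y - x‖₁ ≤ d_{G′}(x,y)` (`a, b ≥ 0`, `M ≥ 1`). [folklore] -/
theorem l1_le_gridWedge_dist (ha : 0 ≤ a) (hb : 0 ≤ b) (hM : 1 ≤ M) (x y : gridWedge a b M) :
    |(y : Site 2) 0 - (x : Site 2) 0| + |(y : Site 2) 1 - (x : Site 2) 1| ≤ (gridWedgeGraph a b M).dist x y := by
  obtain ⟨w, hw⟩ := (gridWedge_reachable ha hb hM x y).exists_walk_length_eq_dist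
  have := l1_le_length_induce w
  rw [hw] at this
  exact this

/-! ## The inclusion is a rough isometry -/

/-- **The inclusion `V(G′_M) ↪ ℤ²` is a rough isometry** in the sense of Lyons–Peres (2.20), with `α = 1` and `β = 4M`:
`d_{G′}(x,y) - 4M ≤ d_{ℤ²}(x,y) ≤ d_{G′}(x,y) + 4M`, and every lattice point is within distance `M/2 ≤ 4M` of `V(G′)`
(`gridLines_dense`). (`a, b ≥ 0`, `M ≥ 1`.) [cite: LyonsPeres2016, §2.6 (2.20) (p. 44)] -/
theorem isRoughIsometry_val_gridWedge (ha : 0 ≤ a) (hb : 0 ≤ b) (hM : 1 ≤ M) :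
    IsRoughIsometry (gridWedgeGraph a b M) (zdGraph 2) (Subtype.val : gridWedge a b M → Site 2) := by
  have hM' : (1 : ℝ) ≤ M := by exact_mod_cast hM
  refine ⟨1, 4 * M, one_pos, by positivity, fun x y => ?_, fun x' => ?_⟩
  · have h1 := zd_dist_eq_l1 (x : Site 2) (y : Site 2)
    have h2 := gridWedge_dist_le ha hb hM x y
    have h3 := l1_le_gridWedge_dist ha hb hM x y
    have h2' : (((gridWedgeGraph a b M).dist x y : ℕ) : ℝ) ≤
        (((zdGraph 2).dist (x : Site 2) (y : Site 2) : ℕ) : ℝ) + 4 * M := by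
      have : ((gridWedgeGraph a b M).dist x y : ℤ) ≤ ((zdGraph 2).dist (x : Site 2) (y : Site 2) : ℤ) + 4 * M := by
        rw [h1]; exact h2
      exact_mod_cast this
    have h3' : (((zdGraph 2).dist (x : Site 2) (y : Site 2) : ℕ) : ℝ) ≤ (((gridWedgeGraph a b M).dist x y : ℕ) : ℝ) := by
      have : ((zdGraph 2).dist (x : Site 2) (y : Site 2) : ℤ) ≤ ((gridWedgeGraph a b M).dist x y : ℤ) := by
        rw [h1]; exact h3
      exact_mod_cast this
    constructor
    · rw [inv_one, one_mul]; linarith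
    · rw [one_mul]; linarith [show (0 : ℝ) ≤ 4 * M by positivity]
  · obtain ⟨y, hy, hy1, hy0⟩ := gridLines_dense hM x'
    refine ⟨⟨y, gridLines_subset_gridWedge a b M hy⟩, ?_⟩
    have h1 := zd_dist_eq_l1 x' y
    rw [hy1, sub_self, abs_zero, add_zero] at h1
    have h2 : ((zdGraph 2).dist x' y : ℤ) ≤ (M : ℤ) := by
      rw [h1, abs_sub_comm]
      have := abs_nonneg (x' 0 - y 0)
      linarith
    have h3 : (((zdGraph 2).dist x' y : ℕ) : ℝ) ≤ (M : ℝ) := by exact_mod_cast h2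
    show (((zdGraph 2).dist x' y : ℕ) : ℝ) ≤ 4 * M
    linarith

/-- **`G′_M` and `ℤ²` are roughly isometric** (`a, b ≥ 0`, `M ≥ 1`). [cite: LyonsPeres2016, §2.6 (2.20) (p. 44)] -/
theorem roughlyIsometric_gridWedge_zd (ha : 0 ≤ a) (hb : 0 ≤ b) (hM : 1 ≤ M) :
    RoughlyIsometric (gridWedgeGraph a b M) (zdGraph 2) :=
  ⟨Subtype.val, isRoughIsometry_val_gridWedge ha hb hM⟩

/-! ## The subdivided lattice `ℤ²[L_M]` is rough-isometric to `ℤ²` as well -/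

/-- `d_{ℤ²[L_M]}(x,y) ≤ ‖y - x‖₁ + 2M` (`M ≥ 1`; `exists_walk_of_grid`). [folklore] -/
theorem subdividedLattice_dist_le (hM : 1 ≤ M) (x y : gridLines M) :
    ((((zdGraph 2).induce (gridLines M)).dist x y : ℕ) : ℤ) ≤
      |(y : Site 2) 0 - (x : Site 2) 0| + |(y : Site 2) 1 - (x : Site 2) 1| + 2 * M := by
  obtain ⟨u, hu⟩ := x
  obtain ⟨v, hv⟩ := y
  have eu : u = ![u 0, u 1] := by ext k; fin_cases k <;> rfl
  have ev : v = ![v 0, v 1] := by ext k; fin_cases k <;> rfl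
  have hu' : (![u 0, u 1] : Site 2) ∈ gridLines M := eu ▸ hu
  have hv' : (![v 0, v 1] : Site 2) ∈ gridLines M := ev ▸ hv
  obtain ⟨w, hw⟩ := exists_walk_of_grid (S := gridLines M) hM (fun z hz => hz) hu' hv' hu' hv'
  have h1 : (⟨u, hu⟩ : gridLines M) = ⟨![u 0, u 1], hu'⟩ := Subtype.ext eu
  have h2 : (⟨v, hv⟩ : gridLines M) = ⟨![v 0, v 1], hv'⟩ := Subtype.ext ev
  rw [h1, h2]
  have := SimpleGraph.dist_le w
  calc ((((zdGraph 2).induce (gridLines M)).dist ⟨![u 0, u 1], hu'⟩ ⟨![v 0, v 1], hv'⟩ : ℕ) : ℤ) ≤ w.length := by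
        exact_mod_cast this
    _ ≤ _ := by simpa using hw

/-- **The inclusion `L_M ↪ ℤ²` is a rough isometry** (`α = 1`, `β = 2M`, `M ≥ 1`): the quasi-transitive subdivided lattice
`ℤ²[L_M]`, the gridded wedge `G′_M` and `ℤ²` are pairwise roughly isometric. [cite: LyonsPeres2016, §2.6 (2.20) (p. 44)] -/
theorem isRoughIsometry_val_subdividedLattice (hM : 1 ≤ M) :
    IsRoughIsometry ((zdGraph 2).induce (gridLines M)) (zdGraph 2) (Subtype.val : gridLines M → Site 2) := by
  have hM' : (1 : ℝ) ≤ M := by exact_mod_cast hM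
  refine ⟨1, 2 * M, one_pos, by positivity, fun x y => ?_, fun x' => ?_⟩
  · have h1 := zd_dist_eq_l1 (x : Site 2) (y : Site 2)
    have h2 := subdividedLattice_dist_le hM x y
    -- `ℤ²[L_M]` is connected: a walk between any two grid points (`exists_walk_of_grid`)
    have hreach : ((zdGraph 2).induce (gridLines M)).Reachable x y := by
      obtain ⟨u, hu⟩ := x
      obtain ⟨v, hv⟩ := y
      have eu : u = ![u 0, u 1] := by ext k; fin_cases k <;> rfl
      have ev : v = ![v 0, v 1] := by ext k; fin_cases k <;> rfl
      have hu' : (![u 0, u 1] : Site 2) ∈ gridLines M := eu ▸ hu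
      have hv' : (![v 0, v 1] : Site 2) ∈ gridLines M := ev ▸ hv
      obtain ⟨w, -⟩ := exists_walk_of_grid (S := gridLines M) hM (fun z hz => hz) hu' hv' hu' hv'
      have h1 : (⟨u, hu⟩ : gridLines M) = ⟨![u 0, u 1], hu'⟩ := Subtype.ext eu
      have h2 : (⟨v, hv⟩ : gridLines M) = ⟨![v 0, v 1], hv'⟩ := Subtype.ext ev
      rw [h1, h2]
      exact ⟨w⟩
    obtain ⟨w, hw⟩ := hreach.exists_walk_length_eq_dist
    have h3 : |(y : Site 2) 0 - (x : Site 2) 0| + |(y : Site 2) 1 - (x : Site 2) 1| ≤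
        ((zdGraph 2).induce (gridLines M)).dist x y := by
      have := l1_le_length_induce w
      rwa [hw] at this
    have h2' : ((((zdGraph 2).induce (gridLines M)).dist x y : ℕ) : ℝ) ≤
        (((zdGraph 2).dist (x : Site 2) (y : Site 2) : ℕ) : ℝ) + 2 * M := by
      have : ((((zdGraph 2).induce (gridLines M)).dist x y : ℕ) : ℤ) ≤
          ((zdGraph 2).dist (x : Site 2) (y : Site 2) : ℤ) + 2 * M := by rw [h1]; exact h2
      exact_mod_cast this
    have h3' : (((zdGraph 2).dist (x : Site 2) (y : Site 2) : ℕ) : ℝ) ≤ ((((zdGraph 2).induce (gridLines M)).dist x y : ℕ) : ℝ) := by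
      have : ((zdGraph 2).dist (x : Site 2) (y : Site 2) : ℤ) ≤ ((((zdGraph 2).induce (gridLines M)).dist x y : ℕ) : ℤ) := by
        rw [h1]; exact h3
      exact_mod_cast this
    constructor
    · rw [inv_one, one_mul]; linarith
    · rw [one_mul]; linarith [show (0 : ℝ) ≤ 2 * M by positivity]
  · obtain ⟨y, hy, hy1, hy0⟩ := gridLines_dense hM x'
    refine ⟨⟨y, hy⟩, ?_⟩
    have h1 := zd_dist_eq_l1 x' y
    rw [hy1, sub_self, abs_zero, add_zero] at h1
    have h2 : ((zdGraph 2).dist x' y : ℤ) ≤ (M : ℤ) := by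
      rw [h1, abs_sub_comm]
      have := abs_nonneg (x' 0 - y 0)
      linarith
    have h3 : (((zdGraph 2).dist x' y : ℕ) : ℝ) ≤ (M : ℝ) := by exact_mod_cast h2
    show (((zdGraph 2).dist x' y : ℕ) : ℝ) ≤ 2 * M
    linarith

end Summit.CriticalPhenomena.PercolationContinuityZ3.Theorems.TransplantSharpness

end
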